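import Summits.QuantumFields.BalabanUV.Beta.WilsonBackgroundWard22TraceRot

/-!
# The traced (bgW₂) rotation term IN BAŁABAN'S LETTERS: `t = gen τ` for a COMPLETE generator family, the `ℂ`-trace — `α = 1`, `β = −N`,
# `γ = 1 − N²`, so the coefficient of `WilsonBackgroundWard22TraceRot.bgWard22_trace_eval` is `α − γ = N²`

Sequel (§5) of `WilsonBackgroundWard22TraceRot` (READ ITS HEADER): the two DISPLAYED algebraic hypotheses (Fz)∕(Cas) of that file DISCHARGED for
Bałaban's anti-Hermitian letters `gen τ c = i·τ_c` (`PlaquetteVertex.gen`) of a complete generator family (`ColourTrace.Complete`, Fierz) against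
the `ℂ`-linear matrix trace: `gen_fierz` (`Σ_a t_a M t_a = M − (N·Tr M)•1`, from `ColourTrace.sandwich` and `i² = −1`), `gen_casimir`
(`Σ_a t_a t_a = (1 − N²)•1`), hence **`bgWard22_trace_eval_gen`**: the fluctuation-colour trace of (bgW₂) is the explicit two-term law with coefficient
`N²` — NO remainder, and the `(N² − 1)`-part of the traced `(2,2)` table is invisible to the background-gauge Ward identity (the lineage's toy
READING 3, journal l.9794, now kernel-checked at letter level).  The `ℂ`-trace is used because Fierz needs the full trace; the cell's `rntr = Re Tr∕N`
reading of the jets is the real part of this identity for real bond patterns (not restated here).  Mathlib's `L¹–L^∞` operator norm on square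
matrices is enabled as a LOCAL instance (the statement is norm-free), exactly as in an3's `PlaquetteVertex` ∕ `PlaquetteVertex2Trace`.

NOT IN PRINT; OUR BOOKKEEPING (cell `pub-balaban`, β sub-cell, D1 swarm seat `b2b-balaban-beta-d1-formalise-leaf-05` gen 4; CLAIM «D1-L4-W22-TRACED-
ROTATION»).  HONEST FRAMING (cell contract, verbatim): «discharging `BetaPertH` makes Bałaban's UV stability UNCONDITIONAL — a real constructive-QFT
result; it is NOT the continuum limit and NOT the Clay problem.»  HONEST DEPENDENCY (verbatim): «continuum YM on T⁴ ⇐ BetaPertH ∧ nine spine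
estimates (0/9 proved); BetaPertH ⇐ (D1) ∧ (D4) ∧ CAP+tail; G-an2-4 gates asym, D1 and NE2/3/4.»  THIS FILE DISCHARGES NOTHING of the wall; 0 of 4
binders; not D1, not BetaPertH, not continuum, not Clay.  ABSOLUTE RULE (cell, verbatim): «No internally-minted statement may enter as a cited fact.
Every hypothesis is either kernel-proved in this package or a verbatim quotation of a PUBLISHED theorem with page reference. The manuscript(s) under
audit are NOT citable for their own disputed steps — they are the thing under adjudication; programme-internal (2001/route/tribunal) claims are
never citable.»  Nothing cited; no `def`; [folklore] colour algebra over `ColourTrace` BY NAME.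
-/

namespace Summit.QuantumFields.BalabanUV.Beta.WilsonBackgroundWard22TraceRot

open Literature.MathematicalPhysics.QuantumFieldTheory.Balaban1983to89.Beta.TransportVertices
open Literature.MathematicalPhysics.QuantumFieldTheory.Balaban1983to89.Beta.WilsonVertex
open Literature.MathematicalPhysics.QuantumFieldTheory.Balaban1983to89.Beta.WilsonVertex2
open scoped BigOperators

section Balaban

open Literature.MathematicalPhysics.QuantumFieldTheory.Balaban1983to89.Beta.ColourTrace (Complete sandwich)
open Literature.MathematicalPhysics.QuantumFieldTheory.Balaban1983to89.Beta.PlaquetteVertex (gen)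

-- Mathlib's `L¹–L^∞` operator norm on square matrices as the (statement-irrelevant) carrier norm, as in an3's `PlaquetteVertex`.
attribute [local instance] Matrix.linftyOpNormedRing Matrix.linftyOpNormedAlgebra

variable {N : ℕ} {C : Type*} [Fintype C]

/-- [folklore] **(Fz) IN BAŁABAN'S LETTERS**: for a complete generator family `τ` (`ColourTrace.Complete`, Fierz) and `t = gen τ = i·τ`,
`Σ_a t_a M t_a = M − (N·Tr M)•1` for EVERY matrix `M` (`ColourTrace.sandwich`; `i² = −1`) — i.e. `α = 1`, `β = −N` against the `ℂ`-trace. -/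
theorem gen_fierz {τ : C → Matrix (Fin N) (Fin N) ℂ} (hτ : Complete τ) (M : Matrix (Fin N) (Fin N) ℂ) :
    ∑ a, gen τ a * M * gen τ a =
      (1 : ℂ) • M + ((-(N : ℂ)) * Matrix.traceLinearMap (Fin N) ℂ ℂ M) • (1 : Matrix (Fin N) (Fin N) ℂ) := by
  have h := sandwich hτ M
  simp only [gen, Matrix.smul_mul, Matrix.mul_smul, smul_smul, Complex.I_mul_I, ← Finset.smul_sum, h,
    Matrix.traceLinearMap_apply]
  module

/-- [folklore] **(Cas) IN BAŁABAN'S LETTERS**: `Σ_a t_a t_a = (1 − N²)•1` (`ColourTrace.sandwich` at `M = 1`, `Tr 1 = N`) — i.e. `γ = 1 − N²`. -/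
theorem gen_casimir {τ : C → Matrix (Fin N) (Fin N) ℂ} (hτ : Complete τ) :
    ∑ a, gen τ a * gen τ a = (1 - (N : ℂ) ^ 2) • (1 : Matrix (Fin N) (Fin N) ℂ) := by
  have h := sandwich hτ 1
  simp only [Matrix.mul_one, Matrix.trace_one, Fintype.card_fin] at h
  simp only [gen, Matrix.smul_mul, Matrix.mul_smul, smul_smul, Complex.I_mul_I, ← Finset.smul_sum, h]
  module

/-- [folklore] **THE TRACED (bgW₂) IN BAŁABAN'S LETTERS — EXPLICIT, REMAINDER-FREE, COEFFICIENT `N²`.**  For a complete generator family `τ`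
(`t = gen τ`), the `ℂ`-trace, traceless gauge letters `l₁, l₂, l₄`, any `l₃`, any bond pattern `c` and ANY background letters `B`:
`Σ_a 4·Pol_B F₂₂(h_a; B, W₀λ) = −2N²·𝒬(c; l; B)` — §4 with `α − γ = N²`; the `(N² − 1)`-part of the traced `(2,2)` table is invisible to the
background-gauge Ward identity (READING 3 of the lineage's toy record, now kernel-checked at letter level). -/
theorem bgWard22_trace_eval_gen {τ : C → Matrix (Fin N) (Fin N) ℂ} (hτ : Complete τ) (l₁ l₂ l₃ l₄ : Matrix (Fin N) (Fin N) ℂ)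
    (hl₁ : Matrix.trace l₁ = 0) (hl₂ : Matrix.trace l₂ = 0) (hl₄ : Matrix.trace l₄ = 0) (c₁ c₂ c₃ c₄ : ℂ)
    (B₁ B₂ B₃ B₄ : Matrix (Fin N) (Fin N) ℂ) :
    (∑ a, ((4 : ℂ) • Matrix.trace (P22 ℂ (plaq (c₁ • gen τ a) (c₂ • gen τ a) (c₃ • gen τ a) (c₄ • gen τ a)
          (B₁ + (l₁ - l₂)) (B₂ + (l₂ - l₃)) (B₃ + (l₄ - l₃)) (B₄ + (l₁ - l₄))))
        - (4 : ℂ) • Matrix.trace (P22 ℂ (plaq (c₁ • gen τ a) (c₂ • gen τ a) (c₃ • gen τ a) (c₄ • gen τ a) B₁ B₂ B₃ B₄))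
        - (4 : ℂ) • Matrix.trace (P22 ℂ (plaq (c₁ • gen τ a) (c₂ • gen τ a) (c₃ • gen τ a) (c₄ • gen τ a)
          (l₁ - l₂) (l₂ - l₃) (l₄ - l₃) (l₁ - l₄))))) =
      -(2 * ((N : ℂ) ^ 2 *
        (2 * (c₁ * c₂ * (Matrix.trace ((B₁ + B₂ - B₃ - B₄) * l₂) - Matrix.trace ((B₁ + B₂ - B₃ - B₄) * l₁))
              - c₁ * c₃ * (Matrix.trace ((B₁ + B₂ - B₃ - B₄) * l₄) - Matrix.trace ((B₁ + B₂ - B₃ - B₄) * l₁))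
              - c₂ * c₃ * (Matrix.trace ((B₁ + B₂ - B₃ - B₄) * l₄) - Matrix.trace ((B₁ + B₂ - B₃ - B₄) * l₂))
              - c₂ * c₄ * (Matrix.trace ((B₁ + B₂ - B₃ - B₄) * l₁) - Matrix.trace ((B₁ + B₂ - B₃ - B₄) * l₂))
              + c₃ * c₄ * (Matrix.trace ((B₁ + B₂ - B₃ - B₄) * l₁) - Matrix.trace ((B₁ + B₂ - B₃ - B₄) * l₄)))
          - 4 * (c₁ + c₂ - c₃ - c₄) *
            (c₂ * Matrix.trace (B₁ * l₂) - c₃ * Matrix.trace ((B₁ + B₂ - B₃) * l₄)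
              - c₄ * Matrix.trace ((B₁ + B₂ - B₃ - B₄) * l₁))
          + 4 * Matrix.trace ((c₁ • l₁ + c₂ • l₂ - c₃ • l₄ - c₄ • l₁) *
              (c₂ • B₁ - c₃ • (B₁ + B₂ - B₃) - c₄ • (B₁ + B₂ - B₃ - B₄)))))) := by
  have h := bgWard22_trace_eval ℂ (Matrix.traceLinearMap (Fin N) ℂ ℂ) (fun a b => Matrix.trace_mul_comm a b) (gen τ)
    (gen_fierz hτ) (gen_casimir hτ) l₁ l₂ l₃ l₄ hl₁ hl₂ hl₄ c₁ c₂ c₃ c₄ B₁ B₂ B₃ B₄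
  have e : (1 : ℂ) - (1 - (N : ℂ) ^ 2) = (N : ℂ) ^ 2 := by ring
  simpa only [Matrix.traceLinearMap_apply, e] using h

end Balaban

end Summit.QuantumFields.BalabanUV.Beta.WilsonBackgroundWard22TraceRot
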